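import Summits.QuantumFields.BalabanUV.Beta.FP.TorusCompositeCovarianceTwoPolarSym
import Summits.QuantumFields.BalabanUV.Beta.FP.PeriodisedSymBorderIndexWard

/-!
# `BalabanUV.Beta.FP.TorusCompositeIndexWardOneSym` — row D1 ∕ (C1) OWNER an2 (gen 66) for the road «FP», ROUTE T, (β1) «sym» column: **(T-β-m) ORDER 1 AT EVERY
# DEPTH FOR THE (0.4)-SYMMETRISED TOWER — THE SYM COMPOSITE FIRST-ORDER INSERTION JET ALONG A TORUS PURE GAUGE IS THE COMMUTATOR OF THE SYM COMPOSITE AVERAGING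
# WITH THE DIAGONAL GAUGE GENERATORS (read at the ITERATED CENTRED ROOTS on the coarse side)** — the (β1) twin of leaf-02 g22's ROOTED
# `FP/TorusCompositeIndexWardOne` §1–§2, proofs line for line under `stepIns₁ M Lc (rs 1) ↦ stepIns₁Sym M Lc`, `compIns₁ ↦ compIns₁Sym`, `compRows ↦ compRowsSym`,
# `Qstep Lc M ℓ r ↦ QstepSym Lc M ℓ`, `rootPt M Lc (hrs 1) ↦ rootPt M Lc hc`, `itRoot Lc M rs hrs ↦ itRoot Lc M (fun _ => ctrOff (d+1) Lc) (fun _ => hc)`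

WHY (an2 g66 J-NOTE-4 ∕ A-1, journal l.67584 ∕ l.67586).  The END wrapper v4's 𝔔-side content row `hQN₁` reads the conjugated jet
`𝔔′₁f v = Xbf v·𝔔₀ + 𝔔₁f v + 𝔔₀·(−c • diagonal (lv v ∘ fst))` with `𝔔₁f v = c • compIns₁Sym … (n+2) (hv v)` (J-NOTE-4 certificate (a)) and `𝔔₀ = compRowsSym … (n+2)`
((e)); with the free read-out `Xbf v := c • diagonal (lv v ∘ itRoot^{ρ_c} (n+2) ∘ fst)` the conjugation is `c •` the sym composite jet along the pure gauge `tgrad·(lv v)`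
(THIS FILE's `compIns₁Sym_pureGauge_fun`), so `𝔔′₁f v = c • compIns₁Sym … (hv v + tgrad·(lv v))` (certificate (f)) and (J-W″) makes the direction `r • colN̂`: the 𝔔-side
junction (E4e) is then F4-Sym (`TorusCompositeVertexJunctionSym`) + an2 PART 11 `perF_dper_VbN_eq_sum` + PART 12 + the lock row `hcVH` (RULING R-D1-g66-1).
THIS FILE types the one missing brick: leaf-02 g22's pure-gauge law for the ROOTED composite (`TorusCompositeIndexWardOne`), re-based on the sym one-step law
`PeriodisedSymBorderIndexWard.torus_sym_pureGauge_fun_of_presentation` (leaf-02), C2-Sym's `compIns₁Sym` chain rule and `compRowsSym_mul_tgrad`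
(`TorusCompositeCovarianceOneSym`); the linearity of `stepIns₁Sym ∕ compIns₁Sym` in the direction is leaf-02's (`TorusCompositeCovarianceTwoPolarSym`
`stepIns₁Sym_add ∕ _smul`, `compIns₁Sym_add ∕ _smul`), READ BY NAME.

WHAT ([folklore] finite sums BY NAME over leaf-02∕leaf-06's typed sym objects `stepIns₁Sym ∕ compIns₁Sym ∕ QstepSym ∕ compRowsSym ∕ rootPt ∕ itRoot ∕ tgrad ∕ tdelta`;
no `def`, no `def … : Prop`, nothing cited, 0 sorry; the only hypothesis is `hc : ctrOff (d+1) Lc ∈ box (d+1) Lc`, met by `ctrOff_mem_box` at `1 ≤ Lc`):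
§1 **`stepIns₁Sym_pureGauge_fun`**: `stepIns₁Sym M Lc (Dλ) = c_ℓ • (diagonal (λ (rootPt M Lc hc a.1)) · QstepSym Lc M ℓ − QstepSym Lc M ℓ ·
diagonal (λ b.1))`, `c_ℓ = (Lc^{d+1}·stepScale d Lc ℓ)⁻¹`, for EVERY `ℓ` (the sym one-step jet is level-free).  §2 `compRowsSym_mulVec_tgrad_fun` (`compRowsSym … n · (Dλ) = σ_n • D_M (λ ∘ itRoot^{ρ_c} n)`), `compIns₁Sym_pureGauge_step`, **`compIns₁Sym_pureGauge_fun`**: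
`compIns₁Sym Lc M lev rs n (Dλ) = diagonal (λ (itRoot^{ρ_c} n a.1)) · compRowsSym … n − compRowsSym … n · diagonal (λ b.1)` — no constants survive.
WHAT THIS IS NOT: not the door's `q1` letter (the rooted §3 `torus_q1_tower`; for the sym tower it is the wrapper's own `h𝔔'₁f` regrouping, done in the (E4e) file);
not (E4e); not F4-Sym; no row of the END wrapper discharged; nothing of the dictionary ∕ Bałaban's asserted, valued or discharged; 0 estimates; 0∕4 row-D1 binders
(hW, hR, D1Tel, D1Rep); ROOT M‴ p325680 ∕ P5c ∕ D6 untouched; NOT (C1), NOT (L2′), NOT (T-ID), NOT SDF, NOT D1, NEVER «G-an2-4 closed», NOT BetaPertH, NOT continuum, NOT Clay.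

HONEST DEPENDENCY (page 1, mandatory): continuum YM on T⁴ ⇐ BetaPertH ∧ nine spine estimates (0/9 proved); BetaPertH ⇐ (D1) ∧ (D4) ∧ CAP+tail;
G-an2-4 gates asym, D1 and NE2/3/4.  HONEST FRAMING (cell contract, verbatim): «discharging `BetaPertH` makes Bałaban's UV stability UNCONDITIONAL —
a real constructive-QFT result; it is NOT the continuum limit and NOT the Clay problem.»  ABSOLUTE RULE (cell charter, verbatim): «No internally-minted
statement may enter as a cited fact. Every hypothesis is either kernel-proved in this package or a verbatim quotation of a PUBLISHED theorem with page
reference. The manuscript(s) under audit are NOT citable for their own disputed steps — they are the thing under adjudication; programme-internal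
(2001/route/tribunal) claims are never citable.»  Row D1 ∕ (C1) OWNER an2 (b2b-balaban-beta-an2) gen 66, 2026-08-27.  No existing file touched.
-/

noncomputable section

open scoped BigOperators

namespace Summit.QuantumFields.BalabanUV.Beta.FP.TorusCompositeIndexWardOneSym

open Matrix Finset
open Literature.MathematicalPhysics.QuantumFieldTheory
open Literature.MathematicalPhysics.QuantumFieldTheory.Balaban1983to89
open Literature.MathematicalPhysics.QuantumFieldTheory.Balaban1983to89.Beta
open B5Prop11Plancherel (fine)
open B6Lemma24Torus (pbox)
open AffineAveraging (Site box toSite unitVec)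
open AveragingContoursRooted (ctr ctrOff ctrOff_mem_box)
open OneStepResolventKernel (Fib)
open Summit.QuantumFields.BalabanUV.Beta.BorderedHessian (stepScale stepScale_ne_zero)
open Summit.QuantumFields.BalabanUV.Beta.FP.KernelPeriodisationFib (Idx perF)
open Summit.QuantumFields.BalabanUV.Beta.FP.KernelPeriodisationFibLoc (dper)
open Summit.QuantumFields.BalabanUV.Beta.FP.TorusGaugeCovariance (tdelta tgrad)
open Summit.QuantumFields.BalabanUV.Beta.FP.TorusGaugeCovariancePairing (wrapPt wrapPt_of_mem sum_tdelta_mul)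
open Summit.QuantumFields.BalabanUV.Beta.FP.TorusGaugeCovarianceCoarse (coarsePt coarsePt_coe)
open Summit.QuantumFields.BalabanUV.Beta.FP.PeriodisedSymBorderIndexWard (torus_sym_pureGauge_fun_of_presentation)
open Summit.QuantumFields.BalabanUV.Beta.FP.TorusCompositeObjects
open Summit.QuantumFields.BalabanUV.Beta.FP.TorusCompositeObjectsG (QstepSym compRowsSym compRowsSym_succ compRowsSym_zero)
open Summit.QuantumFields.BalabanUV.Beta.FP.TorusCompositeCovariance (rootPt rootPt_coe itRoot itRoot_zero itRoot_succ)
open Summit.QuantumFields.BalabanUV.Beta.FP.TorusCompositeCovarianceOne (prod_stepScale_mul_card_ne_zero')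
open Summit.QuantumFields.BalabanUV.Beta.FP.TorusStepInsertionSym (stepIns₁Sym)
open Summit.QuantumFields.BalabanUV.Beta.FP.TorusCompositeCovarianceOneSym (compIns₁Sym compIns₁Sym_zero compIns₁Sym_succ compRowsSym_mul_tgrad)
open Summit.QuantumFields.BalabanUV.Beta.FP.TorusCompositeCovarianceTwoPolarSym (stepIns₁Sym_add stepIns₁Sym_smul compIns₁Sym_add compIns₁Sym_smul)

variable {d : ℕ}

/-! ## §1 The sym one-step jet along a pure gauge -/

section OneStep

variable (M : Fin (d + 1) → ℕ) [∀ μ, NeZero (M μ)] (Lc : ℕ) [NeZero Lc]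

/-- [folklore] **THE SYM ONE-STEP JET ALONG A TORUS PURE GAUGE IS THE COMMUTATOR WITH THE DIAGONAL GAUGE GENERATORS** (leaf-02's
`PeriodisedSymBorderIndexWard.torus_sym_pureGauge_fun_of_presentation` at the coarse presentation `a ↦ (coarsePt M Lc a.1, inr a.2)`, in `stepIns₁Sym ∕ QstepSym ∕ rootPt`
letters; ANY level `ℓ`, the sym jet is level-free): `stepIns₁Sym (Dλ) = c_ℓ • (diagonal (λ (rootPt M Lc hc a.1)) · QstepSym Lc M ℓ − QstepSym Lc M ℓ · diagonal (λ b.1))`. -/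
theorem stepIns₁Sym_pureGauge_fun (hc : ctrOff (d + 1) Lc ∈ box (d + 1) Lc) (ℓ : ℕ) (lam : ↥(pbox (fine Lc M)) → ℝ) :
    stepIns₁Sym M Lc (fun b : ↥(pbox (fine Lc M)) × Fin (d + 1) => ∑ s : ↥(pbox (fine Lc M)), tgrad (fine Lc M) (b.1, Sum.inl b.2) s * lam s)
      = ((Lc : ℝ) ^ (d + 1) * stepScale d Lc ℓ)⁻¹ •
          (Matrix.diagonal (fun a : ↥(pbox M) × Fin (d + 1) => lam (rootPt M Lc hc a.1)) * QstepSym Lc M ℓ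
            - QstepSym Lc M ℓ * Matrix.diagonal (fun b : ↥(pbox (fine Lc M)) × Fin (d + 1) => lam b.1)) := by
  have hR : (Matrix.diagonal fun a : ↥(pbox M) × Fin (d + 1) =>
        ∑ s : ↥(pbox (fine Lc M)), tdelta (fine Lc M) ((coarsePt M Lc a.1 : Site (d + 1)) + ctr (d + 1) Lc) s * lam s)
      = Matrix.diagonal fun a : ↥(pbox M) × Fin (d + 1) => lam (rootPt M Lc hc a.1) := by
    refine congrArg Matrix.diagonal (funext fun a => ?_)
    rw [show (coarsePt M Lc a.1 : Site (d + 1)) + ctr (d + 1) Lc = ((rootPt M Lc hc a.1 : ↥(pbox (fine Lc M))) : Site (d + 1)) from rfl,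
      sum_tdelta_mul, wrapPt_of_mem]
  rw [stepIns₁Sym, ← hR]
  exact torus_sym_pureGauge_fun_of_presentation (M := fine Lc M) (M'' := M) (fun _ => rfl) ℓ lam
    (fun a : ↥(pbox M) × Fin (d + 1) => (coarsePt M Lc a.1 : Site (d + 1))) (fun a => (coarsePt M Lc a.1).2) (fun a => a.2) rfl

end OneStep

/-! ## §2 The sym composite jet along a pure gauge -/

section Tower

variable (Lc : ℕ) [NeZero Lc]

/-- [folklore] **THE SYM COMPOSITE AVERAGING OF A PURE GAUGE IS A PURE GAUGE OF `λ ∘ itRoot^{ρ_c}` ON THE TOP TORUS**, times `σ_n` (C2-Sym's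
`compRowsSym_mul_tgrad` on the vector `λ`): `compRowsSym … n · (Dλ) = σ_n · D_M (λ ∘ itRoot^{ρ_c} n)`, the iterated root at the constant CENTRED list. -/
theorem compRowsSym_mulVec_tgrad_fun (hc : ctrOff (d + 1) Lc ∈ box (d + 1) Lc) (n : ℕ) (M : Fin (d + 1) → ℕ) [∀ μ, NeZero (M μ)] (lev : ℕ → ℕ)
    (rs : ℕ → (Fin (d + 1) → ℕ)) (lam : ↥(pbox (towerTorus Lc M n)) → ℝ) :
    compRowsSym Lc M lev rs n *ᵥ (fun b : ↥(pbox (towerTorus Lc M n)) × Fin (d + 1) =>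
        ∑ s : ↥(pbox (towerTorus Lc M n)), tgrad (towerTorus Lc M n) (b.1, Sum.inl b.2) s * lam s)
      = (∏ i ∈ range n, (stepScale d Lc (lev (i + 1)) * ((box (d + 1) Lc).card : ℝ))) •
          (fun a : ↥(pbox M) × Fin (d + 1) => ∑ t : ↥(pbox M), tgrad M (a.1, Sum.inl a.2) t
            * lam (itRoot Lc M (fun _ => ctrOff (d + 1) Lc) (fun _ => hc) n t)) := by
  have e : (fun b : ↥(pbox (towerTorus Lc M n)) × Fin (d + 1) => ∑ s : ↥(pbox (towerTorus Lc M n)), tgrad (towerTorus Lc M n) (b.1, Sum.inl b.2) s * lam s)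
      = (tgrad (towerTorus Lc M n)).submatrix
          (fun b : ↥(pbox (towerTorus Lc M n)) × Fin (d + 1) => ((b.1, Sum.inl b.2) : Idx (towerTorus Lc M n) (Fib d))) id *ᵥ lam := rfl
  rw [e, Matrix.mulVec_mulVec, compRowsSym_mul_tgrad Lc hc n M lev rs, Matrix.smul_mulVec, ← Matrix.mulVec_mulVec]
  congr 1
  funext a
  simp only [Matrix.mulVec, dotProduct, Matrix.submatrix_apply, id, Matrix.of_apply, sum_tdelta_mul, wrapPt_of_mem]

/-- [folklore] **(T-β-m)-Sym ORDER 1, THE INDUCTION STEP** (push-inside types): the top step's sym jet along the transported pure gauge `σ_n·D(λ ∘ itRoot^{ρ_c} n)`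
is `c_ℓ·σ_n·θ_n = 1` times `R′·QstepSym − QstepSym·R` (`stepIns₁Sym_pureGauge_fun` at `λ ∘ itRoot^{ρ_c} n`), and `QstepSym·(R·C − C·E)` from below: the
`R`-terms cancel. -/
theorem compIns₁Sym_pureGauge_step (hc : ctrOff (d + 1) Lc ∈ box (d + 1) Lc) (n : ℕ) (M : Fin (d + 1) → ℕ) [∀ μ, NeZero (M μ)] (lev : ℕ → ℕ)
    (rs : ℕ → (Fin (d + 1) → ℕ)) (lam : ↥(pbox (towerTorus Lc (fine Lc M) n)) → ℝ)
    (ih : compIns₁Sym Lc (fine Lc M) (fun k => lev (k + 1)) (fun k => rs (k + 1)) n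
        (fun b : ↥(pbox (towerTorus Lc (fine Lc M) n)) × Fin (d + 1) =>
          ∑ s : ↥(pbox (towerTorus Lc (fine Lc M) n)), tgrad (towerTorus Lc (fine Lc M) n) (b.1, Sum.inl b.2) s * lam s)
      = Matrix.diagonal (fun a : ↥(pbox (fine Lc M)) × Fin (d + 1) =>
            lam (itRoot Lc (fine Lc M) (fun _ => ctrOff (d + 1) Lc) (fun _ => hc) n a.1))
          * compRowsSym Lc (fine Lc M) (fun k => lev (k + 1)) (fun k => rs (k + 1)) n
        - compRowsSym Lc (fine Lc M) (fun k => lev (k + 1)) (fun k => rs (k + 1)) n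
          * Matrix.diagonal (fun b : ↥(pbox (towerTorus Lc (fine Lc M) n)) × Fin (d + 1) => lam b.1)) :
    (((Lc : ℝ) ^ (d + 1) * stepScale d Lc (lev 1)) * (∏ i ∈ range n, (stepScale d Lc (lev (i + 1 + 1)) * ((box (d + 1) Lc).card : ℝ)))⁻¹) •
          (stepIns₁Sym M Lc ((compRowsSym Lc (fine Lc M) (fun k => lev (k + 1)) (fun k => rs (k + 1)) n) *ᵥ
              (fun b : ↥(pbox (towerTorus Lc (fine Lc M) n)) × Fin (d + 1) =>
                ∑ s : ↥(pbox (towerTorus Lc (fine Lc M) n)), tgrad (towerTorus Lc (fine Lc M) n) (b.1, Sum.inl b.2) s * lam s))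
            * compRowsSym Lc (fine Lc M) (fun k => lev (k + 1)) (fun k => rs (k + 1)) n)
        + QstepSym Lc M (lev 1) * compIns₁Sym Lc (fine Lc M) (fun k => lev (k + 1)) (fun k => rs (k + 1)) n
            (fun b : ↥(pbox (towerTorus Lc (fine Lc M) n)) × Fin (d + 1) =>
              ∑ s : ↥(pbox (towerTorus Lc (fine Lc M) n)), tgrad (towerTorus Lc (fine Lc M) n) (b.1, Sum.inl b.2) s * lam s)
      = Matrix.diagonal (fun a : ↥(pbox M) × Fin (d + 1) =>
            lam (itRoot Lc (fine Lc M) (fun _ => ctrOff (d + 1) Lc) (fun _ => hc) n (rootPt M Lc hc a.1)))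
          * (QstepSym Lc M (lev 1) * compRowsSym Lc (fine Lc M) (fun k => lev (k + 1)) (fun k => rs (k + 1)) n)
        - QstepSym Lc M (lev 1) * compRowsSym Lc (fine Lc M) (fun k => lev (k + 1)) (fun k => rs (k + 1)) n
          * Matrix.diagonal (fun b : ↥(pbox (towerTorus Lc (fine Lc M) n)) × Fin (d + 1) => lam b.1) := by
  have hB : (box (d + 1) Lc).Nonempty := ⟨ctrOff (d + 1) Lc, hc⟩
  have hθ : ((Lc : ℝ) ^ (d + 1) * stepScale d Lc (lev 1)) * (∏ i ∈ range n, (stepScale d Lc (lev (i + 1 + 1)) * ((box (d + 1) Lc).card : ℝ)))⁻¹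
      * ((∏ i ∈ range n, (stepScale d Lc (lev (i + 1 + 1)) * ((box (d + 1) Lc).card : ℝ))) * ((Lc : ℝ) ^ (d + 1) * stepScale d Lc (lev 1))⁻¹) = 1 := by
    rw [← mul_assoc, inv_mul_cancel_right₀ (prod_stepScale_mul_card_ne_zero' Lc hB (fun i => lev (i + 1 + 1)) n),
      mul_inv_cancel₀ (mul_ne_zero (pow_ne_zero _ (by exact_mod_cast NeZero.ne Lc)) (stepScale_ne_zero _))]
  rw [compRowsSym_mulVec_tgrad_fun Lc hc n (fine Lc M) _ _ lam, stepIns₁Sym_smul,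
    stepIns₁Sym_pureGauge_fun M Lc hc (lev 1) (fun t => lam (itRoot Lc (fine Lc M) (fun _ => ctrOff (d + 1) Lc) (fun _ => hc) n t)), ih,
    smul_smul, Matrix.smul_mul, smul_smul, hθ, one_smul]
  simp only [Matrix.sub_mul, Matrix.mul_sub, Matrix.mul_assoc]
  abel

/-- [folklore] **`compIns₁Sym_pureGauge_fun` — (T-β-m)-Sym ORDER 1: THE SYM COMPOSITE FIRST-ORDER INSERTION JET ALONG A TORUS PURE GAUGE IS THE COMMUTATOR OF THE
SYM COMPOSITE AVERAGING WITH THE DIAGONAL GAUGE GENERATORS**, at every depth: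
`compIns₁Sym … n (Dλ) = diagonal (λ (itRoot^{ρ_c} n a.1)) · compRowsSym … n − compRowsSym … n · diagonal (λ b.1)`
(fields: `λ` at the base of their bond on the finest torus; multipliers: `λ` at the ITERATED CENTRED ROOT of their coarse site).  No constants survive. -/
theorem compIns₁Sym_pureGauge_fun (hc : ctrOff (d + 1) Lc ∈ box (d + 1) Lc) :
    ∀ (n : ℕ) (M : Fin (d + 1) → ℕ) [∀ μ, NeZero (M μ)] (lev : ℕ → ℕ) (rs : ℕ → (Fin (d + 1) → ℕ))
      (lam : ↥(pbox (towerTorus Lc M n)) → ℝ),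
      compIns₁Sym Lc M lev rs n (fun b : ↥(pbox (towerTorus Lc M n)) × Fin (d + 1) =>
          ∑ s : ↥(pbox (towerTorus Lc M n)), tgrad (towerTorus Lc M n) (b.1, Sum.inl b.2) s * lam s)
        = Matrix.diagonal (fun a : ↥(pbox M) × Fin (d + 1) => lam (itRoot Lc M (fun _ => ctrOff (d + 1) Lc) (fun _ => hc) n a.1))
            * compRowsSym Lc M lev rs n
          - compRowsSym Lc M lev rs n * Matrix.diagonal (fun b : ↥(pbox (towerTorus Lc M n)) × Fin (d + 1) => lam b.1)
  | 0, M, _, lev, rs, lam => by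
    show (0 : Matrix (↥(pbox M) × Fin (d + 1)) (↥(pbox M) × Fin (d + 1)) ℝ)
      = Matrix.diagonal (fun a : ↥(pbox M) × Fin (d + 1) => lam a.1) * (1 : Matrix (↥(pbox M) × Fin (d + 1)) (↥(pbox M) × Fin (d + 1)) ℝ)
        - (1 : Matrix (↥(pbox M) × Fin (d + 1)) (↥(pbox M) × Fin (d + 1)) ℝ) * Matrix.diagonal (fun b : ↥(pbox M) × Fin (d + 1) => lam b.1)
    rw [Matrix.mul_one, Matrix.one_mul, sub_self]
  | n + 1, M, _, lev, rs, lam =>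
    compIns₁Sym_pureGauge_step Lc hc n M lev rs lam
      (compIns₁Sym_pureGauge_fun hc n (fine Lc M) (fun k => lev (k + 1)) (fun k => rs (k + 1)) lam)

end Tower

end Summit.QuantumFields.BalabanUV.Beta.FP.TorusCompositeIndexWardOneSym

end
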